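import Literature.Probability.LatticeModels.RandomClusterArmConditioning
import HarnessLib

/-!
# Successive conditioning along an increasing event, relative to a context event (proved)

Topic `Literature/Probability/LatticeModels` (trunk `StatMech`, family `crit-ising`). The "junk"
estimate of Kesten's ratio-limit scheme (H. Kesten, *The incipient infinite cluster in
two-dimensional percolation*, PTRF 73 (1986), proof of Thm. 3, the estimate "(8)") in the
generality of the finite-graph random-cluster measure `φ = rcMeasure G p q B`, `q ≥ 1`, and in the
conditional-cylinder language of `RandomClusterSuccessiveConditioning.lean` /
`RandomClusterArmConditioning.lean`, now RELATIVE TO A CONTEXT EVENT `F` (outer exploration data,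
closed-edge cylinders, ...) which is determined by the configuration off every region `U_i` but need
not be monotone:

* `rcMeasure_real_inter_inter_compl_inter_cylinder_le` — ONE REGION: if the increasing event `S`
  has conditional probability `≥ c` given the cylinder `C = {ω | ω ∩ T = ξ}`
  (`c φ(C) ≤ φ(S ∩ C)`), then for every increasing `A` and every event `F` determined by `ω ∩ T`,
  `φ(A ∩ F ∩ Sᶜ ∩ C) ≤ (1 - c) φ(A ∩ F ∩ C)`: `F` is constant on the cylinder, so this is either
  trivial or the case `F = univ` (`rcMeasure_real_inter_compl_inter_cylinder_le`, strong positive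
  association, Grimmett 2006 Thm. (3.8)(b));
* `rcMeasure_real_inter_inter_biInter_compl_le` — `N` REGIONS: for pairwise disjoint edge regions
  `U_i`, increasing events `S_i` determined on `U_i` with conditional lower bounds `c_i ≤ 1`
  uniformly in the configuration off `U_i`, any increasing `A` and any `F` determined off every
  `U_i`, `φ(A ∩ F ∩ ⋂_i S_iᶜ) ≤ (∏_i (1 - c_i)) · φ(A ∩ F)` (induction over the regions, as in
  `rcMeasure_real_inter_biInter_compl_le`, carrying `A ∩ F` along; the event `⋂_{j ≠ i} S_jᶜ` is
  determined off `U_i`).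

With `A = {x ↔ y}`, `S_i` = "an open separating path in the `i`-th sub-annulus" and `F` the data of
an outer exploration this is the input "given the context, the arm occurs but none of `N` annuli
contains an open separating path has probability `≤ (1 - c)^N φ(arm ∩ context)`" of the
arm-origin-forgetting step of Kesten's argument (Kesten 1986, proof of Thm. 3; for FK percolation
the RSW lower bounds uniform in boundary conditions are Duminil-Copin–Hongler–Nolin 2011 /
Chelkak–Duminil-Copin–Hongler 2016). Everything is proved; no definitions.

## References

* H. Kesten, The incipient infinite cluster in two-dimensional percolation, *Probab. Theory
  Related Fields* 73 (1986) 369–394: proof of Thm. 3.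
* G. Grimmett, *The Random-Cluster Model*, Springer (2006): Thm. (3.8)(b) (strong positive
  association), §4.2 Lemma (4.13).
-/

noncomputable section

open MeasureTheory Finset SimpleGraph

namespace Literature.Probability.LatticeModels

section Finite

variable {V : Type*} [Fintype V] [DecidableEq V] (G : SimpleGraph V) [DecidableRel G.Adj]

/-- **One region, relative to a context event: an increasing event does not suppress a
conditionally likely increasing event** (Kesten 1986, proof of Thm. 3; strong positive association,
Grimmett 2006 Thm. (3.8)(b)). If `S` is increasing with `c · φ(C) ≤ φ(S ∩ C)` on the cylinder
`C = {ω | ω ∩ T = ξ}`, then for every increasing `A` and every event `F` determined by the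
configuration on `T` (hence constant on `C`), `φ(A ∩ F ∩ Sᶜ ∩ C) ≤ (1 - c) · φ(A ∩ F ∩ C)`.
[cite: Grimmett2006, Thm. (3.8)(b)] -/
theorem rcMeasure_real_inter_inter_compl_inter_cylinder_le {p q : ℝ} (hp : p ∈ Set.Icc (0 : ℝ) 1)
    (hq : 1 ≤ q) (B : Set V) (T ξ : Set (Sym2 V)) {A S F : Set (Percolation.BondConfig V)}
    (hA : IsUpperSet A) (hS : IsUpperSet S)
    (hF : ∀ ω₁ ω₂ : Percolation.BondConfig V, ω₁ ∩ T = ω₂ ∩ T → (ω₁ ∈ F ↔ ω₂ ∈ F)) {c : ℝ}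
    (hc : c * (rcMeasure G p q B).real {ω | ω ∩ T = ξ} ≤
      (rcMeasure G p q B).real (S ∩ {ω | ω ∩ T = ξ})) :
    (rcMeasure G p q B).real (A ∩ F ∩ Sᶜ ∩ {ω | ω ∩ T = ξ}) ≤
      (1 - c) * (rcMeasure G p q B).real (A ∩ F ∩ {ω | ω ∩ T = ξ}) := by
  by_cases hFC : ∃ ω₀ ∈ F, ω₀ ∩ T = ξ
  · -- the cylinder lies inside `F`
    obtain ⟨ω₀, hω₀F, hω₀⟩ := hFC
    have hCF : ∀ ω : Percolation.BondConfig V, ω ∩ T = ξ → ω ∈ F :=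
      fun ω hω ↦ (hF ω ω₀ (hω.trans hω₀.symm)).2 hω₀F
    have h1 : A ∩ F ∩ Sᶜ ∩ {ω | ω ∩ T = ξ} = A ∩ Sᶜ ∩ {ω | ω ∩ T = ξ} := by
      ext ω
      constructor
      · rintro ⟨⟨⟨hωA, -⟩, hωS⟩, hωC⟩
        exact ⟨⟨hωA, hωS⟩, hωC⟩
      · rintro ⟨⟨hωA, hωS⟩, hωC⟩
        exact ⟨⟨⟨hωA, hCF ω hωC⟩, hωS⟩, hωC⟩
    have h2 : A ∩ F ∩ {ω | ω ∩ T = ξ} = A ∩ {ω | ω ∩ T = ξ} := by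
      ext ω
      constructor
      · rintro ⟨⟨hωA, -⟩, hωC⟩
        exact ⟨hωA, hωC⟩
      · rintro ⟨hωA, hωC⟩
        exact ⟨⟨hωA, hCF ω hωC⟩, hωC⟩
    rw [h1, h2]
    exact rcMeasure_real_inter_compl_inter_cylinder_le G hp hq B T ξ hA hS hc
  · -- the cylinder misses `F`: both sides vanish
    push Not at hFC
    have h1 : A ∩ F ∩ Sᶜ ∩ {ω | ω ∩ T = ξ} = ∅ := by
      refine Set.subset_empty_iff.1 ?_
      rintro ω ⟨⟨⟨-, hωF⟩, -⟩, hωC⟩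
      exact hFC ω hωF hωC
    have h2 : A ∩ F ∩ {ω | ω ∩ T = ξ} = ∅ := by
      refine Set.subset_empty_iff.1 ?_
      rintro ω ⟨⟨-, hωF⟩, hωC⟩
      exact hFC ω hωF hωC
    rw [h1, h2, measureReal_empty, mul_zero]

/-- **Successive conditioning along an increasing event, relative to a context event** (Kesten
1986, proof of Thm. 3: "given the outer data, the arm but no open circuit in `k` annuli costs
`(1 - c)^k`"). Let `U_i`, `i ∈ s`, be pairwise disjoint sets of edges, `S_i` increasing events
determined by the configuration on `U_i`, and `c_i ≤ 1` constants with
`c_i · φ({ω ∖ U_i = ξ}) ≤ φ(S_i ∩ {ω ∖ U_i = ξ})` for every configuration `ξ` off `U_i`. Then for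
every increasing event `A` and every event `F` determined by the configuration off each `U_i`
(not necessarily monotone), `φ(A ∩ F ∩ ⋂_{i ∈ s} S_iᶜ) ≤ (∏_{i ∈ s} (1 - c_i)) · φ(A ∩ F)`
(`0 ≤ p ≤ 1`, `q ≥ 1`). [cite: Kesten1986, proof of Thm. 3] -/
theorem rcMeasure_real_inter_inter_biInter_compl_le {p q : ℝ} (hp : p ∈ Set.Icc (0 : ℝ) 1)
    (hq : 1 ≤ q) (B : Set V) {ι : Type*} (s : Finset ι) (U : ι → Finset (Sym2 V))
    (hdisj : (s : Set ι).Pairwise fun i j ↦ Disjoint (U i) (U j))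
    (S : ι → Set (Percolation.BondConfig V)) (hS : ∀ i ∈ s, IsUpperSet (S i))
    (hSdet : ∀ i ∈ s, ∀ ω₁ ω₂ : Percolation.BondConfig V,
      ω₁ ∩ ↑(U i) = ω₂ ∩ ↑(U i) → (ω₁ ∈ S i ↔ ω₂ ∈ S i))
    (c : ι → ℝ) (hc1 : ∀ i ∈ s, c i ≤ 1)
    (hc : ∀ i ∈ s, ∀ ξ : Finset (Sym2 V), ξ ⊆ G.edgeFinset \ U i →
      c i * (rcMeasure G p q B).real {ω | ω ∩ (↑(U i) : Set (Sym2 V))ᶜ = ↑ξ} ≤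
        (rcMeasure G p q B).real (S i ∩ {ω | ω ∩ (↑(U i) : Set (Sym2 V))ᶜ = ↑ξ}))
    {A : Set (Percolation.BondConfig V)} (hA : IsUpperSet A)
    {F : Set (Percolation.BondConfig V)}
    (hF : ∀ i ∈ s, ∀ ω₁ ω₂ : Percolation.BondConfig V,
      ω₁ ∩ (↑(U i) : Set (Sym2 V))ᶜ = ω₂ ∩ (↑(U i) : Set (Sym2 V))ᶜ → (ω₁ ∈ F ↔ ω₂ ∈ F)) :
    (rcMeasure G p q B).real (A ∩ F ∩ ⋂ i ∈ s, (S i)ᶜ) ≤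
      (∏ i ∈ s, (1 - c i)) * (rcMeasure G p q B).real (A ∩ F) := by
  classical
  have hq0 : 0 < q := one_pos.trans_le hq
  haveI := isProbabilityMeasure_rcMeasure G hp hq0 B
  induction s using Finset.induction_on with
  | empty =>
    rw [Finset.prod_empty, one_mul]
    exact measureReal_mono Set.inter_subset_left (measure_ne_top _ _)
  | insert a s ha ih =>
    have hdisj' : ((s : Set ι)).Pairwise fun i j ↦ Disjoint (U i) (U j) :=
      hdisj.mono (by simp)
    have ih' := ih hdisj' (fun i hi ↦ hS i (Finset.mem_insert_of_mem hi))
      (fun i hi ↦ hSdet i (Finset.mem_insert_of_mem hi))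
      (fun i hi ↦ hc1 i (Finset.mem_insert_of_mem hi))
      (fun i hi ↦ hc i (Finset.mem_insert_of_mem hi))
      (fun i hi ↦ hF i (Finset.mem_insert_of_mem hi))
    rw [Finset.set_biInter_insert, Finset.prod_insert ha]
    -- `⋂_{i ∈ s} (S i)ᶜ` is determined off `U a`
    have hdet : ∀ ω₁ ω₂ : Percolation.BondConfig V, ω₁ ∩ (↑(U a))ᶜ = ω₂ ∩ (↑(U a))ᶜ →
        (ω₁ ∈ ⋂ i ∈ s, (S i)ᶜ ↔ ω₂ ∈ ⋂ i ∈ s, (S i)ᶜ) := by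
      intro ω₁ ω₂ h
      simp only [Set.mem_iInter, Set.mem_compl_iff]
      refine forall₂_congr fun i hi ↦ not_congr ?_
      have hai : a ≠ i := fun h' ↦ ha (h' ▸ hi)
      exact determined_off_of_determined_on_disjoint
        ((hdisj (Finset.mem_insert_of_mem hi) (Finset.mem_insert_self a s) hai.symm))
        (hSdet i (Finset.mem_insert_of_mem hi)) ω₁ ω₂ h
    -- one region, uniformly in the configuration off `U a`; `F` is determined off `U a`
    have hstep : ∀ ξ : Finset (Sym2 V), ξ ⊆ G.edgeFinset \ U a →
        (rcMeasure G p q B).real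
            ((A ∩ F ∩ (S a)ᶜ) ∩ {ω | ω ∩ (↑(U a) : Set (Sym2 V))ᶜ = ↑ξ}) ≤
          (1 - c a) *
            (rcMeasure G p q B).real ((A ∩ F) ∩ {ω | ω ∩ (↑(U a) : Set (Sym2 V))ᶜ = ↑ξ}) :=
      fun ξ hξ ↦ rcMeasure_real_inter_inter_compl_inter_cylinder_le G hp hq B _ _ hA
        (hS a (Finset.mem_insert_self a s)) (hF a (Finset.mem_insert_self a s))
        (hc a (Finset.mem_insert_self a s) ξ hξ)
    have h1ca : 0 ≤ 1 - c a := sub_nonneg.2 (hc1 a (Finset.mem_insert_self a s))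
    calc (rcMeasure G p q B).real (A ∩ F ∩ ((S a)ᶜ ∩ ⋂ i ∈ s, (S i)ᶜ))
        = (rcMeasure G p q B).real ((A ∩ F ∩ (S a)ᶜ) ∩ ⋂ i ∈ s, (S i)ᶜ) := by
          rw [← Set.inter_assoc]
      _ ≤ (1 - c a) * (rcMeasure G p q B).real ((A ∩ F) ∩ ⋂ i ∈ s, (S i)ᶜ) :=
          rcMeasure_real_inter_le_mul_inter_of_cylinder_le G hp hq0 B (U a) hdet hstep
      _ ≤ (1 - c a) * ((∏ i ∈ s, (1 - c i)) * (rcMeasure G p q B).real (A ∩ F)) :=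
          mul_le_mul_of_nonneg_left ih' h1ca
      _ = ((1 - c a) * ∏ i ∈ s, (1 - c i)) * (rcMeasure G p q B).real (A ∩ F) := by ring

end Finite

end Literature.Probability.LatticeModels

end
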